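import Literature.MathematicalPhysics.QuantumFieldTheory.Balaban1983to89.BlockAveragingEMLLinearisedBackground
import HarnessLib

/-!
# Route `UnitScaleTilt`, crux K1 child «MinimiserStabilityRegPr» (stmt-QuantumFields-19200), registered stub `stub_prop7From14` (leaf V3 «Prop 7 from a
# background (14)») — THE RELATIVE HOLONOMY OF `U = (1+Y)U₀` ALONG AN ARBITRARY WALK, TO FIRST ORDER, WITH A PER-STEP (`ℓ²`-ALONG-THE-WALK) REMAINDER:
# `‖U(Γ)U₀(Γ)* − 1 − Y_{U₀}(Γ)‖ ≤ Π_{s∈Γ}(1 + ‖Y_{b(s)}‖) − 1 − Σ_{s∈Γ}‖Y_{b(s)}‖ + Σ_{s∈Γ}‖Y_{b(s)}‖² ≤ 2·(Σ_{s∈Γ}‖Y_{b(s)}‖)²`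

Cell `ym3-torus` ∕ fleet seat `ym-ust-19200-p1` (gen 4).  WHERE THIS SITS.  The one-step linearisation of the (0.4) averaging of record at a small-field background
(`BlockAveragingEMLLinearisedBackground.norm_avgFun_ratio_sub_one_sub_covLinAvg_le`, p484812) rests on `norm_holRatio_bounds`: along a walk `Γ` of `m` steps,
`‖U(Γ)U₀(Γ)* − 1 − Y_{U₀}(Γ)‖ ≤ (1+δ)^m − 1 − mδ + mδ²` with the UNIFORM bound `‖Y‖ ≤ δ` — a remainder quadratic in `m·max‖Y‖`.  The `ℓ²` route to the uniqueness
clause of [Balaban1985Variational] Prop. 7 (CARD-19200-V3-g4, D1c (iii)) needs the remainder of the averaging map quadratic in the `ℓ²` MASS of `Y` along the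
contours (else a volume factor `L^{kd}` is lost against `Σ‖Y‖²`); step (a) of that programme is the per-step form of `norm_holRatio_bounds`, proved here by the
same recursion `D(s·Γ) = Z_s + R(g_s)D(Γ) + Z_s·R(g_s)D(Γ)` with `‖Z_s‖ ≤ ‖Y_{b(s)}‖`, `‖Z_s − covStep‖ ≤ ‖Y_{b(s)}‖²` (no uniform `δ`).  Steps (b) (an `ℓ²`-mean
form of the `exp`-mean-`log` remainder `norm_eml_add_sub_sub_mean_le`) and (c) (assembly over the loop words of (0.4)) remain.

WHAT IS PROVED HERE (sorry-free, no definition; [folklore]).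
* §1 `SU(N)` letters (operator norm): the step factors are unitary, conjugation by them is norm-non-increasing.
* §2 **`norm_holRatio_bounds_perStep`**: for every walk `Γ`, `‖D(Γ)‖ ≤ Π_{s∈Γ}(1+‖Y_{b(s)}‖) − 1` and
  `‖D(Γ) − Y_{U₀}(Γ)‖ ≤ Π_{s∈Γ}(1+‖Y_{b(s)}‖) − 1 − Σ_{s∈Γ}‖Y_{b(s)}‖ + Σ_{s∈Γ}‖Y_{b(s)}‖²` (`D(Γ) = U(Γ)U₀(Γ)* − 1`, `Y = pertVar U₀ U`, `Y_{U₀} = covWalkSum U₀ Y`).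
* §3 real letters (`Π_{l}(1+a) ≤ e^{Σa}`, `Σa² ≤ (Σa)²`) and **`norm_holRatio_sub_covWalkSum_le_two_mul_sq`**: if `Σ_{s∈Γ}‖Y_{b(s)}‖ ≤ 1` then
  `‖D(Γ) − Y_{U₀}(Γ)‖ ≤ 2·(Σ_{s∈Γ}‖Y_{b(s)}‖)²` (hence `≤ 2|Γ|·Σ_{s∈Γ}‖Y_{b(s)}‖²` by Cauchy–Schwarz, the consumer's one line).

Nothing of Bałaban's is asserted.

References: T. Bałaban, CMP 98 (1985) 17–51 [Balaban1985Averaging] ((56)–(58) p.27, (122)–(123) p.36); CMP 102 (1985) 277–309 [Balaban1985Variational] ((44) p.285).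
-/

noncomputable section

open scoped BigOperators Matrix.Norms.L2Operator

namespace Summit.QuantumFields.YangMills.Theorems.Prop7HolRatioPerStep

open Literature.MathematicalPhysics.QuantumFieldTheory.Balaban1983to89
open T4Continuum BlockAveraging BlockAveragingEMLLinearised BlockAveragingEMLLinearisedBackground

variable {n : Type*} [Fintype n] [DecidableEq n] [Nonempty n] {P : Params} {j : ℕ}

/-! ## §1 `SU(N)` letters -/

omit [Nonempty n] in
/-- `g*·g = 1` for `g ∈ SU(N)` read in `M_N(ℂ)`. [folklore] -/
theorem coe_star_mul_self (g : Matrix.specialUnitaryGroup n ℂ) : star (g : Matrix n n ℂ) * (g : Matrix n n ℂ) = 1 :=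
  Matrix.mem_unitaryGroup_iff'.mp (Matrix.specialUnitaryGroup_le_unitaryGroup g.2)

omit [Nonempty n] in
/-- `g·g* = 1` for `g ∈ SU(N)` read in `M_N(ℂ)`. [folklore] -/
theorem coe_mul_star_self (g : Matrix.specialUnitaryGroup n ℂ) : (g : Matrix n n ℂ) * star (g : Matrix n n ℂ) = 1 :=
  Matrix.mem_unitaryGroup_iff.mp (Matrix.specialUnitaryGroup_le_unitaryGroup g.2)

/-- `‖g‖ = 1` for `g ∈ SU(N)` (operator norm). [folklore] -/
theorem norm_coe_eq_one (g : Matrix.specialUnitaryGroup n ℂ) : ‖(g : Matrix n n ℂ)‖ = 1 :=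
  CStarRing.norm_of_mem_unitary (Matrix.specialUnitaryGroup_le_unitaryGroup g.2)

/-- `‖g*‖ = 1` for `g ∈ SU(N)`. [folklore] -/
theorem norm_star_coe_eq_one (g : Matrix.specialUnitaryGroup n ℂ) : ‖star (g : Matrix n n ℂ)‖ = 1 := by
  rw [norm_star, norm_coe_eq_one]

omit [Nonempty n] in
/-- The step factor is unitary: `g_s·g_s* = 1`. [folklore] -/
theorem stepFactor_mul_star' (U₀ : GaugeField P j (Matrix.specialUnitaryGroup n ℂ)) (s : LStep P j) :
    stepFactor U₀ s * star (stepFactor U₀ s) = 1 := by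
  unfold stepFactor
  cases s.fwd
  · simp only [Bool.false_eq_true, ↓reduceIte, star_star]; exact coe_star_mul_self _
  · simp only [↓reduceIte]; exact coe_mul_star_self _

omit [Nonempty n] in
/-- The step factor is unitary: `g_s*·g_s = 1`. [folklore] -/
theorem star_mul_stepFactor' (U₀ : GaugeField P j (Matrix.specialUnitaryGroup n ℂ)) (s : LStep P j) :
    star (stepFactor U₀ s) * stepFactor U₀ s = 1 := by
  unfold stepFactor
  cases s.fwd
  · simp only [Bool.false_eq_true, ↓reduceIte, star_star]; exact coe_mul_star_self _
  · simp only [↓reduceIte]; exact coe_star_mul_self _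

/-- `‖g_s‖ = 1`. [folklore] -/
theorem norm_stepFactor' (U₀ : GaugeField P j (Matrix.specialUnitaryGroup n ℂ)) (s : LStep P j) : ‖stepFactor U₀ s‖ = 1 := by
  unfold stepFactor
  cases s.fwd
  · simp only [Bool.false_eq_true, ↓reduceIte]; exact norm_star_coe_eq_one _
  · simp only [↓reduceIte]; exact norm_coe_eq_one _

/-- Conjugation by a step factor does not increase the norm: `‖g X g*‖ ≤ ‖X‖`. [folklore] -/
theorem norm_conj_stepFactor_le' (U₀ : GaugeField P j (Matrix.specialUnitaryGroup n ℂ)) (s : LStep P j) (X : Matrix n n ℂ) :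
    ‖stepFactor U₀ s * X * star (stepFactor U₀ s)‖ ≤ ‖X‖ := by
  calc _ ≤ ‖stepFactor U₀ s‖ * ‖X‖ * ‖star (stepFactor U₀ s)‖ := (norm_mul_le _ _).trans (mul_le_mul_of_nonneg_right (norm_mul_le _ _) (norm_nonneg _))
    _ = ‖X‖ := by rw [norm_star, norm_stepFactor', one_mul, mul_one]

/-- `‖g* − 1‖ = ‖g − 1‖` for `g ∈ SU(N)` (`g* − 1 = −g*(g − 1)`). [folklore] -/
theorem norm_star_sub_one_eq (g : Matrix.specialUnitaryGroup n ℂ) : ‖star (g : Matrix n n ℂ) - 1‖ = ‖(g : Matrix n n ℂ) - 1‖ := by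
  have key : ∀ h : Matrix n n ℂ, star h * h = 1 → ‖star h‖ = 1 → ‖star h - 1‖ ≤ ‖h - 1‖ := by
    intro h hh hn
    have e : star h - 1 = -(star h * (h - 1)) := by rw [mul_sub, hh, mul_one]; abel
    rw [e, norm_neg]
    calc ‖star h * (h - 1)‖ ≤ ‖star h‖ * ‖h - 1‖ := norm_mul_le _ _
      _ = ‖h - 1‖ := by rw [hn, one_mul]
  refine le_antisymm (key _ (coe_star_mul_self g) (norm_star_coe_eq_one g)) ?_
  have h2 := key (star (g : Matrix n n ℂ)) (by rw [star_star]; exact coe_mul_star_self g) (by rw [star_star]; exact norm_coe_eq_one g)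
  rwa [star_star] at h2

/-! ## §2 The relative holonomy, per-step bounds -/

/-- **THE RELATIVE HOLONOMY TO FIRST ORDER, PER-STEP REMAINDER**: with `Y = pertVar U₀ U` and `D(Γ) = U(Γ)·U₀(Γ)* − 1`, for every walk `Γ`:
`‖D(Γ)‖ ≤ Π_{s∈Γ}(1 + ‖Y_{b(s)}‖) − 1` and `‖D(Γ) − Y_{U₀}(Γ)‖ ≤ Π_{s∈Γ}(1 + ‖Y_{b(s)}‖) − 1 − Σ_{s∈Γ}‖Y_{b(s)}‖ + Σ_{s∈Γ}‖Y_{b(s)}‖²` — the recursion of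
`BlockAveragingEMLLinearisedBackground.norm_holRatio_bounds` without a uniform bound on `Y`. [cite: Balaban1985Averaging, (122)-(123) p.36] -/
theorem norm_holRatio_bounds_perStep (U₀ U : GaugeField P j (Matrix.specialUnitaryGroup n ℂ)) :
    ∀ γ : List (LStep P j),
      ‖((holAt U γ : Matrix.specialUnitaryGroup n ℂ) : Matrix n n ℂ) * star ((holAt U₀ γ : Matrix.specialUnitaryGroup n ℂ) : Matrix n n ℂ) - 1‖ ≤
          (γ.map fun s => 1 + ‖pertVar U₀ U s.bond‖).prod - 1 ∧
      ‖((holAt U γ : Matrix.specialUnitaryGroup n ℂ) : Matrix n n ℂ) * star ((holAt U₀ γ : Matrix.specialUnitaryGroup n ℂ) : Matrix n n ℂ) - 1 -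
          covWalkSum U₀ (pertVar U₀ U) γ‖ ≤
        (γ.map fun s => 1 + ‖pertVar U₀ U s.bond‖).prod - 1 - (γ.map fun s => ‖pertVar U₀ U s.bond‖).sum
          + (γ.map fun s => ‖pertVar U₀ U s.bond‖ ^ 2).sum
  | [] => by simp [holAt_nil]
  | s :: γ => by
    obtain ⟨ih₀, ih₁⟩ := norm_holRatio_bounds_perStep U₀ U γ
    -- letters
    set F : Matrix n n ℂ := ((holAt U γ : Matrix.specialUnitaryGroup n ℂ) : Matrix n n ℂ) with hF
    set F₀ : Matrix n n ℂ := ((holAt U₀ γ : Matrix.specialUnitaryGroup n ℂ) : Matrix n n ℂ) with hF₀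
    set f : Matrix n n ℂ := stepFactor U s with hf
    set g : Matrix n n ℂ := stepFactor U₀ s with hg
    set D : Matrix n n ℂ := F * star F₀ - 1 with hD
    set Λ : Matrix n n ℂ := covWalkSum U₀ (pertVar U₀ U) γ with hΛ
    set Y : PBond P j → Matrix n n ℂ := pertVar U₀ U with hYdef
    set Pg : ℝ := (γ.map fun s => 1 + ‖Y s.bond‖).prod with hPg
    set Sg : ℝ := (γ.map fun s => ‖Y s.bond‖).sum with hSg
    set Sg2 : ℝ := (γ.map fun s => ‖Y s.bond‖ ^ 2).sum with hSg2
    set δs : ℝ := ‖Y s.bond‖ with hδs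
    have hδs0 : 0 ≤ δs := norm_nonneg _
    -- the exact relative step term `Z = f g* − 1`
    set Z : Matrix n n ℂ := f * star g - 1 with hZ
    have hgg : g * star g = 1 := stepFactor_mul_star' U₀ s
    have hZ0 : ‖Z‖ ≤ δs ∧ ‖Z - covStep U₀ Y s‖ ≤ δs ^ 2 := by
      have hfg := stepFactor_mul_star_stepFactor U₀ U s
      rw [← hf, ← hg, ← hYdef] at hfg
      unfold covStep
      revert hfg
      cases s.fwd <;> intro hfg
      · -- backward: `Z = g ((1+Y)* − 1) g*`
        simp only [Bool.false_eq_true, ↓reduceIte] at hfg ⊢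
        have eZ : Z = g * (star (1 + Y s.bond) - 1) * star g := by
          rw [hZ, hfg, mul_sub, sub_mul, mul_one, hgg]
        have h1Y : 1 + Y s.bond = (((U s.bond * (U₀ s.bond)⁻¹ : Matrix.specialUnitaryGroup n ℂ) : Matrix n n ℂ)) := by
          rw [hYdef, pertVar, add_sub_cancel]
        constructor
        · rw [eZ]
          refine (norm_conj_stepFactor_le' U₀ s _).trans ?_
          rw [h1Y, norm_star_sub_one_eq, hδs, hYdef, pertVar]
        · have e2 : Z - -(g * Y s.bond * star g) = g * (star (1 + Y s.bond) - 1 + Y s.bond) * star g := by rw [eZ]; noncomm_ring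
          rw [e2]
          refine (norm_conj_stepFactor_le' U₀ s _).trans ?_
          have h3 : star (1 + Y s.bond) - 1 + Y s.bond =
              star (((U s.bond * (U₀ s.bond)⁻¹ : Matrix.specialUnitaryGroup n ℂ) : Matrix n n ℂ)) - 1 +
                ((((U s.bond * (U₀ s.bond)⁻¹ : Matrix.specialUnitaryGroup n ℂ) : Matrix n n ℂ)) - 1) := by
            rw [← h1Y, add_sub_cancel_left]
          rw [h3, hδs, hYdef, pertVar]
          exact norm_holRatio_bounds.norm_star_sub_one_add_le' _
      · -- forward: `Z = Y`
        simp only [↓reduceIte] at hfg ⊢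
        have eZ : Z = Y s.bond := by rw [hZ, hfg, add_sub_cancel_left]
        rw [eZ, sub_self, norm_zero]
        exact ⟨le_rfl, by positivity⟩
    obtain ⟨hZδ, hZ1⟩ := hZ0
    -- the recursion `D' = Z + g D g* + Z g D g*`
    have hF' : ((holAt U (s :: γ) : Matrix.specialUnitaryGroup n ℂ) : Matrix n n ℂ) = f * F := by
      rw [coe_holAt_eq_prod_stepFactor, List.map_cons, List.prod_cons, ← coe_holAt_eq_prod_stepFactor]
    have hF₀' : ((holAt U₀ (s :: γ) : Matrix.specialUnitaryGroup n ℂ) : Matrix n n ℂ) = g * F₀ := by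
      rw [coe_holAt_eq_prod_stepFactor, List.map_cons, List.prod_cons, ← coe_holAt_eq_prod_stepFactor]
    have hgg' : star g * g = 1 := star_mul_stepFactor' U₀ s
    have erec : f * F * star (g * F₀) - 1 = Z + g * D * star g + Z * (g * D * star g) := by
      rw [star_mul, hZ, hD]
      have e1 : (f * star g - 1) * (g * (F * star F₀ - 1) * star g) =
          f * (star g * g) * (F * star F₀ - 1) * star g - g * (F * star F₀ - 1) * star g := by noncomm_ring
      rw [e1, hgg', mul_one]
      noncomm_ring
    rw [hF', hF₀', List.map_cons, List.prod_cons, List.map_cons, List.sum_cons, List.map_cons, List.sum_cons, covWalkSum_cons, erec]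
    have hconj : ‖g * D * star g‖ ≤ ‖D‖ := norm_conj_stepFactor_le' U₀ s D
    have hgD : ‖g * D * star g‖ ≤ Pg - 1 := hconj.trans ih₀
    constructor
    · calc ‖Z + g * D * star g + Z * (g * D * star g)‖ ≤ ‖Z‖ + ‖g * D * star g‖ + ‖Z‖ * ‖g * D * star g‖ :=
            (norm_add_le _ _).trans (add_le_add (norm_add_le _ _) (norm_mul_le _ _))
        _ ≤ δs + (Pg - 1) + δs * (Pg - 1) := add_le_add (add_le_add hZδ hgD) (mul_le_mul hZδ hgD (norm_nonneg _) hδs0)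
        _ = (1 + δs) * Pg - 1 := by ring
    · have e : Z + g * D * star g + Z * (g * D * star g) - (covStep U₀ Y s + g * Λ * star g) =
          (Z - covStep U₀ Y s) + g * (D - Λ) * star g + Z * (g * D * star g) := by noncomm_ring
      rw [e]
      calc ‖(Z - covStep U₀ Y s) + g * (D - Λ) * star g + Z * (g * D * star g)‖
          ≤ ‖Z - covStep U₀ Y s‖ + ‖g * (D - Λ) * star g‖ + ‖Z‖ * ‖g * D * star g‖ :=
            (norm_add_le _ _).trans (add_le_add (norm_add_le _ _) (norm_mul_le _ _))
        _ ≤ δs ^ 2 + (Pg - 1 - Sg + Sg2) + δs * (Pg - 1) :=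
            add_le_add (add_le_add hZ1 ((norm_conj_stepFactor_le' U₀ s _).trans ih₁)) (mul_le_mul hZδ hgD (norm_nonneg _) hδs0)
        _ = (1 + δs) * Pg - 1 - (δs + Sg) + (δs ^ 2 + Sg2) := by ring

/-! ## §3 The `ℓ²`-along-the-walk form -/

/-- `Π_{x∈l}(1 + a(x)) ≤ exp(Σ_{x∈l} a(x))` for `a ≥ 0`. [folklore] -/
theorem list_prod_one_add_le_exp_sum {ι : Type*} (a : ι → ℝ) (ha : ∀ x, 0 ≤ a x) :
    ∀ l : List ι, (l.map fun x => 1 + a x).prod ≤ Real.exp (l.map a).sum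
  | [] => by simp
  | x :: l => by
    rw [List.map_cons, List.prod_cons, List.map_cons, List.sum_cons, Real.exp_add]
    have ih := list_prod_one_add_le_exp_sum a ha l
    have h0 : 0 ≤ (l.map fun x => 1 + a x).prod := List.prod_nonneg fun y hy => by
      obtain ⟨z, _, rfl⟩ := List.mem_map.mp hy; linarith [ha z]
    exact mul_le_mul (by linarith [Real.add_one_le_exp (a x)]) ih h0 (Real.exp_pos _).le

/-- `Σ_{x∈l} a(x)² ≤ (Σ_{x∈l} a(x))²` for `a ≥ 0`. [folklore] -/
theorem list_sum_sq_le_sq_sum {ι : Type*} (a : ι → ℝ) (ha : ∀ x, 0 ≤ a x) :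
    ∀ l : List ι, (l.map fun x => a x ^ 2).sum ≤ (l.map a).sum ^ 2
  | [] => by simp
  | x :: l => by
    rw [List.map_cons, List.sum_cons, List.map_cons, List.sum_cons]
    have ih := list_sum_sq_le_sq_sum a ha l
    have h0 : 0 ≤ (l.map a).sum := List.sum_nonneg fun y hy => by obtain ⟨z, _, rfl⟩ := List.mem_map.mp hy; exact ha z
    nlinarith [ha x]

/-- **THE RELATIVE HOLONOMY TO FIRST ORDER WITH REMAINDER QUADRATIC IN THE `ℓ¹` MASS OF `Y` ALONG THE WALK**: if `Σ_{s∈Γ}‖Y_{b(s)}‖ ≤ 1` then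
`‖U(Γ)U₀(Γ)* − 1 − Y_{U₀}(Γ)‖ ≤ 2·(Σ_{s∈Γ}‖Y_{b(s)}‖)²` (hence `≤ 2|Γ|·Σ_{s∈Γ}‖Y_{b(s)}‖²`). [cite: Balaban1985Averaging, (122)-(123) p.36] -/
theorem norm_holRatio_sub_covWalkSum_le_two_mul_sq (U₀ U : GaugeField P j (Matrix.specialUnitaryGroup n ℂ)) (γ : List (LStep P j))
    (hsum : (γ.map fun s => ‖pertVar U₀ U s.bond‖).sum ≤ 1) :
    ‖((holAt U γ : Matrix.specialUnitaryGroup n ℂ) : Matrix n n ℂ) * star ((holAt U₀ γ : Matrix.specialUnitaryGroup n ℂ) : Matrix n n ℂ) - 1 -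
        covWalkSum U₀ (pertVar U₀ U) γ‖ ≤ 2 * ((γ.map fun s => ‖pertVar U₀ U s.bond‖).sum) ^ 2 := by
  have h := (norm_holRatio_bounds_perStep U₀ U γ).2
  set S : ℝ := (γ.map fun s => ‖pertVar U₀ U s.bond‖).sum with hS
  have hS0 : 0 ≤ S := List.sum_nonneg fun y hy => by obtain ⟨z, _, rfl⟩ := List.mem_map.mp hy; exact norm_nonneg _
  have h1 : (γ.map fun s => 1 + ‖pertVar U₀ U s.bond‖).prod ≤ Real.exp S :=
    list_prod_one_add_le_exp_sum (fun s : LStep P j => ‖pertVar U₀ U s.bond‖) (fun _ => norm_nonneg _) γ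
  have h2 : |Real.exp S - 1 - S| ≤ S ^ 2 := Real.abs_exp_sub_one_sub_id_le (by rw [abs_of_nonneg hS0]; exact hsum)
  have h3 : (γ.map fun s => ‖pertVar U₀ U s.bond‖ ^ 2).sum ≤ S ^ 2 :=
    list_sum_sq_le_sq_sum (fun s : LStep P j => ‖pertVar U₀ U s.bond‖) (fun _ => norm_nonneg _) γ
  linarith [le_abs_self (Real.exp S - 1 - S)]

end Summit.QuantumFields.YangMills.Theorems.Prop7HolRatioPerStep

end
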